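import Mathlib
import HarnessLib
import Literature.NumberTheory.LFunctions.KMVFirstMomentBeyondDiagonal
import Summits.Parity.GeneralizedHardyLittlewood.Theses.PrimeLevelFamEdge
import Literature.NumberTheory.LFunctions.KMVMollifierDiagonalMainTerm
import Literature.NumberTheory.LFunctions.KMVSecondMainTermFloorMasses
import Literature.NumberTheory.LFunctions.KowalskiMichelPeterssonFormula
import Literature.NumberTheory.LFunctions.IwaniecSarnakFamilyWeightTwoPeterssonPB

/-!
# BC3 skeleton (rev 6) — crux `PrimeLevelFamEdge.BeyondDiagonalBeatsQuarter` (VALUE, rev-3 closable form)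

Route rev 3 (ls-Bfam-plan g3, 2026-08-27; item stmt-Parity-20343): the VALUE crux is
`FirstMomentPrinted → C′` — GIVEN the printed twisted harmonic first moment at prime level (Bettin 2017,
Thm. 1.1, `Literature.NumberTheory.LFunctions.bettin2017_theorem11_primeLevel`, the route support
`FirstMomentPrinted`, stmt-Parity-20345), whatever valid off-diagonal main terms `T₁, T₂` a window
`(1, Δ]` beyond the diagonal carries, some admissible profile beats `1/4` on SOME open sub-window
`(a, b) ⊆ [1, Δ]` with `a < 3/2`. The printed fact is the crux's ANTECEDENT (rev 4, planner).

REV 6 (lead ls-Bfam-prover-1 g3, R2-G44 re-thread): rev 5's printed stub Pt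
`stub_peterssonFormula : PeterssonPrinted` (= `KowalskiMichel2000.kowalskiMichel2000_petersson`, the
Petersson–Weil display typed for ALL `m, n ≥ 1`) is REFUTED AS TYPED (cell record R2-G44, 2026-08-27:
witness `(m,n) = (q,q)`, `λ_f(q)² = 1/q` on `H₂(q)`; tree theorems
`KowalskiMichel2000.not_kowalskiMichel2000_petersson` p528813 and
`Theorems.PeterssonPrinted.Negative.kowalskiMichel2000_petersson_false_allIndices` p528704; item
stmt-Parity-20012 dead-lettered). It is REPLACED by Pt′ `stub_peterssonBound :
KowalskiMichel2000.kowalskiMichel2000_peterssonBound` — the same display IN ITS PRINTED RANGE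
`¬ (q ∣ m ∧ q ∣ n)` (p528813, ls-Bfam-typer-1 g9; director RULING R2-G44 AMENDED 11:46:35Z: the gcd
form), which is all the floor ever used (indices `(1,1)`, `(q,1)`), stated over the LITERATURE name
so the skeleton survives the route's repair rev (new support item over the same fact, shape (α),
director 11:52:56Z). The composition is re-threaded DIRECTLY through the
masses floor `KMV2000.sq_firstMainTerm_le_secondMainTerm_of_lt_two_of_masses` (Literature
`KMVSecondMainTermFloorMasses`, p529574) fed by the two harmonic-mass roots over the repaired fact
(`CentralValueFamilyHalfEdge.abs_totalMass_sub_one_le_pb` (1,1), `abs_two_mul_evenMass_sub_totalMass_le_pb`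
(q,1); Literature `IwaniecSarnakFamilyWeightTwoPeterssonPB`, p530888) — the skeleton now imports the
route file and Literature only (no Theorems module: theses-cone clean); the same step packaged as
Theorems helpers is `SecondMainTermFloorPeterssonBound` (p530790: `…_of_upper_pb`) and
`HeartIsolationOffDiag` (`beyondDiagonalBeatsQuarter_of_upperSomewhere_X_sq′`). Stubs D and S2u are
byte-identical to rev 5; no ex-falso use of the refuted fact anywhere (smuggling rule).

REV 5 (lead ls-Bfam-prover-1 g2): the rev-4 heart S2 `stub_secondCorrectionBelowSlackSomewhere` asked
`0 < second + T₂ ∧ second + T₂ < 2·lin²` at `X²` on some sub-window below `3/2`. Its POSITIVITY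
conjunct is NOT open: by the Cauchy–Schwarz floor of the second main term
(`KMV2000.sq_firstMainTerm_le_secondMainTerm`, Literature `KMVSecondMainTermFloor`, p524498:
`(lin + T₁)² ≤ second + T₂` — at one prime level the value never exceeds the even share `½`) and S1,
`second + T₂ ≥ 4 > 0` on ALL of `(1, min Δ 2)` modulo the Petersson formula at prime level
(Theorems `BeyondDiagonalBeatsQuarter/SecondMainTermFloor`, p525223). S2 is therefore RESHAPED into
* Pt `stub_peterssonFormula` — PRINTED FACT, not a proving target (rev 5: the route's support item
  `PeterssonPrinted`, stmt-Parity-20012 — REFUTED AS TYPED, see REV 6 above; rev 6: Pt′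
  `stub_peterssonBound : KowalskiMichel2000.kowalskiMichel2000_peterssonBound`, the repaired fact
  p528813, to become the route's repaired support item and a binder of `closes` in the repair rev);
* S2u `stub_secondCorrectionUpperSomewhere` — OPEN, the heart (XL): the UPPER inequality alone,
  `second + T₂ < 2·lin²` at `X²` (equivalently `T₂ Δ' X² 1 < 4(Δ'−1)/Δ'`,
  `Theorems….secondCorrectionBelowSlackSomewhere_of_T₂_band`) on SOME open sub-window
  `(a, b) ⊆ [1, min Δ 2]` with `a < 3/2` — the second mollified moment beyond the diagonal at one
  prime level (registry famE-02, open in print); the floor already forces `T₂ Δ' X² 1 ≥ −4/Δ'`.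
D `stub_mollifierMainTermXSq` stays declared verbatim (LANDED p520179 under this name and signature on
stmt-Parity-20055; census re-link on 20343 pending). Inside `_of`: S1 from the antecedent + D
(`KMV2000.firstCorrectionVanishes_of_bettin`), positivity `second + T₂ ≥ lin² = 4` from Pt′ (masses
floor), the upper inequality from S2u, then the rev-4 algebra
(`0 < D < 2·lin²` ⇒ `lin²/(2D) > 1/4`); `_of` concludes the route decl BY NAME, hypothesis-free.
«The programme SEARCHES and TYPES; no claim about Landau–Siegel zeros, Theorems 1–2 of
arXiv:2211.02515 or a repaired Margin232 until a kernel theorem says so.»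
-/

open Polynomial

namespace Summit.Parity.GeneralizedHardyLittlewood.Theses.PrimeLevelFamEdge

open Literature.NumberTheory.LFunctions

/-- stub D (M; LANDED p520179 under this name and signature): the diagonal Möbius–ψ sum of the first
mollified moment for the profile `X²` has main term `ζ(2)·P′(1)/log M` with error `O(log⁻² M)`.
[cite: KowalskiMichelVanderKam2000, §4.1 (19)–(20), Prop. 4.1 (case k = 0)] -/
theorem stub_mollifierMainTermXSq : KMV2000.MollifierMainTermAsymp (X ^ 2) := by
  sorry

/-- stub Pt′ (PRINTED FACT in its printed range, not a proving target; replaces rev 5's refuted-as-typed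
`stub_peterssonFormula : PeterssonPrinted`): the Petersson formula with Weil's bound at prime level,
weight 2, for all `m, n ≥ 1` NOT BOTH divisible by `q` — `KowalskiMichel2000.kowalskiMichel2000_peterssonBound`
(p528813), the route's repaired support item-to-be (shape (α)) and binder of the repaired `closes`.
[cite: KowalskiMichel2000, §2.3 p. 310 (display after (16)) and §2.4.2 p. 312 (23)] -/
theorem stub_peterssonBound : KowalskiMichel2000.kowalskiMichel2000_peterssonBound := by
  sorry

/-- stub S2u (XL, the heart; OPEN): for the profile `X²` the SECOND-moment off-diagonal correction of a
valid window stays strictly below the diagonal slack, `second + T₂ < 2·lin²` (equivalently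
`T₂ Δ' X² 1 < 4(Δ'−1)/Δ'`), on SOME open sub-window `(a, b) ⊆ [1, min Δ 2]` with `a < 3/2`.
(Rev-4 S2 minus its positivity conjunct, which is proved below.)
[cite: KowalskiMichelVanderKam2000, Thm. 6.1 (30)–(32), §2 footnote 2]
[cite: IwaniecSarnak2000, long-mollifier remark] -/
theorem stub_secondCorrectionUpperSomewhere :
    ∀ Δ : ℝ, 1 < Δ → ∀ T₁ T₂ : ℝ → ℝ[X] → ℝ[X] → ℝ, KMV2000.MomentAsymptotics 1 Δ T₁ T₂ →
      ∃ a b : ℝ, 1 ≤ a ∧ a < b ∧ b ≤ min Δ 2 ∧ a < 3 / 2 ∧ ∀ Δ' : ℝ, a < Δ' → Δ' < b →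
        KMV2000.secondMomentForm Δ' (X ^ 2) 1 + T₂ Δ' (X ^ 2) 1 <
          2 * KMV2000.linForm Δ' (X ^ 2) 1 ^ 2 := by
  sorry

/-- **Composition (kernel-checked): D, Pt′ and S2u give the rev-3 crux** — the antecedent (Bettin's
printed first moment) and D pin `T₁ Δ' (X²) 1 = 0` on `(1, min Δ 2)`
(`KMV2000.firstCorrectionVanishes_of_bettin`); Pt′ at `(1,1)` and `(q,1)` gives the two harmonic-mass
bounds (`CentralValueFamilyHalfEdge.abs_totalMass_sub_one_le_pb`, `abs_two_mul_evenMass_sub_totalMass_le_pb`),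
hence the Cauchy–Schwarz floor `(lin + T₁)² ≤ second + T₂`
(`KMV2000.sq_firstMainTerm_le_secondMainTerm_of_lt_two_of_masses`), i.e. `4 ≤ second + T₂ > 0` at `X²`;
S2u gives `second + T₂ < 2·lin² = 8` on its sub-window; then pure algebra: `0 < D < 2·lin²` ⇒
`lin²/(2D) > 1/4`. -/
theorem BeyondDiagonalBeatsQuarter_of : BeyondDiagonalBeatsQuarter := by
  have hD := stub_mollifierMainTermXSq
  have hPt := stub_peterssonBound
  have h2u := stub_secondCorrectionUpperSomewhere
  intro hF Δ hΔ T₁ T₂ hAsy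
  obtain ⟨a, b, ha, hab, hb, ha32, hval⟩ := h2u Δ hΔ T₁ T₂ hAsy
  refine ⟨a, b, ha, hab, hb.trans (min_le_left _ _), ha32, X ^ 2, KMV2000.admissible_X_sq,
    fun Δ' h1' h2' ↦ ?_⟩
  have h1 : 1 < Δ' := lt_of_le_of_lt ha h1'
  have hΔ'm : Δ' < min Δ 2 := lt_of_lt_of_le h2' hb
  have hT₁ : T₁ Δ' (X ^ 2) 1 = 0 :=
    KMV2000.firstCorrectionVanishes_of_bettin hF hD Δ hΔ T₁ T₂ hAsy Δ' h1 hΔ'm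
  -- the Cauchy–Schwarz floor from the two harmonic-mass bounds (Pt′ at (1,1) and (q,1))
  obtain ⟨Ct, Ht⟩ := CentralValueFamilyHalfEdge.abs_totalMass_sub_one_le_pb hPt
  obtain ⟨Ce, He⟩ := CentralValueFamilyHalfEdge.abs_two_mul_evenMass_sub_totalMass_le_pb hPt
  have hfloor := KMV2000.sq_firstMainTerm_le_secondMainTerm_of_lt_two_of_masses
    ⟨Ct, 3 / 2, by norm_num, fun q _ hq ↦ Ht q hq⟩ ⟨Ce, 1 / 4, by norm_num, fun q _ hq ↦ He q hq⟩
    hAsy KMV2000.admissible_X_sq (by linarith) (lt_of_lt_of_le hΔ'm (min_le_right _ _)) h1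
    (lt_of_lt_of_le hΔ'm (min_le_left _ _)).le
  have hlt := hval Δ' h1' h2'
  rw [hT₁, add_zero] at hfloor ⊢
  -- `lin² ≤ D < 2·lin²` forces `0 < lin²`, `0 < D`, and then `lin²/(2D) > 1/4 ⟺ D < 2·lin²`
  have hl : 0 < KMV2000.linForm Δ' (X ^ 2) 1 ^ 2 := by linarith
  have hpos : 0 < KMV2000.secondMomentForm Δ' (X ^ 2) 1 + T₂ Δ' (X ^ 2) 1 := by linarith
  rw [lt_div_iff₀ (by positivity)]
  linarith

end Summit.Parity.GeneralizedHardyLittlewood.Theses.PrimeLevelFamEdge
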